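import Summits.HodgeConjecture.CorCM.D2Bridge.ClosedPrintedMuKeyIdentLemD3DelRecConjOmegaT
import Summits.HodgeConjecture.CorCM.D2Bridge.PrintedCitationHypothesesT
import Literature.RepresentationTheory.Semisimple.EquivariantIrreducibleDecomposition
import Literature.RepresentationTheory.Semisimple.AdmissibleUnitarySemisimple
import Literature.NumberTheory.Automorphic.MatrixCoefficients
import Literature.NumberTheory.Automorphic.Liu2021.Prop413MultLeOneOfAsPrinted
import Literature.NumberTheory.Automorphic.Liu2021.Prop413MultOneAsPrinted
import Literature.NumberTheory.GelbartRogawski1991.OscillatorTripleDictionary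
import HarnessLib

/-!
# a3-liu413 FACE TYPES — the items, the printed datum and the eight pin-stub `Prop`s of the crux line `Cruxes/H413/Lines/a3_liu413.lean` (binder `h413`), IN THE TREE by name

Cell `hodgecm-mathlib` (D-0151), fan A, crux item H413 = stmt-HodgeConjecture-24833 (route `HCCMUnconditional`; [Liu2021, Prop. 4.13] AS PRINTED at the pin).
DEFINITIONS (with bodies) and the two kernel re-assembly theorems of the crux's §Items; no instance, no notation, no `sorry`, no named fact — net Literature debt 0;
namespace `Summit.HodgeConjecture.CorCM.Lines.A3Liu413` (that of the crux file and of `Theorems/A3Liu413DictionaryStubsByName.lean` etc.).  Same pattern and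
reason as `CorCM/HypLiu418/A3Liu418FaceTypes.lean` (A-p18 p608544), `A3Liu418Items.lean` (A-p19 p605885), `CorCM/HypD3/A4LiuD3Items.lean` (A-p05 p603184):
«D-CLOSURE needs by-name stub TYPES» — the crux workfile is not importable (it carries the registered `sorry` slots), so the Theorems-side closing file
`Summits/HodgeConjecture/HodgeConjecture/Theorems/HCCMUnconditionalH413OfFacts.lean` (`H413_of_facts`, A-p18; director g2 BATCH 28 GO) and any future by-name closer
state their types against THIS file.  The crux file may `import` it and drop its local copies, or keep them: the bodies are identical (δ-reduction either way).

CONTENTS = the tree crux file `a3_liu413.lean` **v7** (md5 `b939adbb2838…`, 578 lines; A-plan2 g1) lines :152–:362 BYTE-FOR-BYTE: §Items `HasIrredDecomposition`,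
`ConstituentsAreTheta` (the two halves of [Prop 4.13] as predicates on a `Prop413Data`), `prop413AsPrinted_of_parts` / `decomposition_of_prop413AsPrinted` (kernel
re-assembly, theorems), the binder restatement `H413 hDel` with `hyp413_iff`, the printed datum `datum413` = `P(F, V, a₀, Φ, i)`, and the eight pin-stub types
`StubIrredDecomposition`, `StubMatsushimaAtPin`, `StubConstituentsTheta`, `StubDictionaryExistenceAtPin`, `StubMultOneAtPin`, `StubAdmissibleAtPin`, `StubSmoothAtPin`,
`StubUnitarizableAtPin`.  Docstrings are those of the crux file.  NOTHING printed is asserted here.  HC_CM is proved only modulo the 7 printed citations until rung 0 closes.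

## References
* [Liu2021] Y. Liu, *Fourier–Jacobi cycles and arithmetic relative trace formula*, Camb. J. Math. 9 (2021) = arXiv:2102.11518: Prop. 4.13 and its proof
  (FJcycle.tex l. 2110–2146), Rem. 4.14, §4.2 l. 2081.
* [GelbartRogawski1991] §3, Thm 5.1.1; [Rogawski1990] Thm. 13.3.1; [BorelWallach2000] VII 3.2; [Li1992] Thm. 5.4.
* Tree: `Cruxes/H413/Lines/a3_liu413.lean` v7; `Theorems/A3Liu413DictionaryStubsByName.lean` (p605572); `CorCM/HypLiu418/A3Liu418FaceTypes.lean` (p608544).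
-/

set_option autoImplicit false

noncomputable section

namespace Summit.HodgeConjecture.CorCM.Lines.A3Liu413

open scoped TensorProduct Matrix
open NumberField NumberField.InfinitePlace
open HodgeCM.Model HodgeCM.Model.LiuIndex HodgeCM.Model.TowerCarrier
open HodgeCM.Literature.Theta.LiuAlbaneseModuleDatum.D2Bridge (HcmPieces)
open Summit.HodgeConjecture.CorCM.Model
open Literature.AlgebraicGeometry.Motives (CMType)
open Literature.AlgebraicGeometry.HodgeTheory Literature.NumberTheory.Automorphic.PicardCM
open Literature.AlgebraicGeometry.ShimuraVarieties.UnitaryCanonicalModel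
open Literature.NumberTheory.ComplexMultiplication
open Literature.NumberTheory.Automorphic
open Literature.NumberTheory.Automorphic.IdeleClassGroup (toHeckeCharacter isUnitary_toHeckeCharacter galConj)
open Literature.NumberTheory.Automorphic.Liu2021 Literature.NumberTheory.Automorphic.Liu2021.AppendixC
open Literature.NumberTheory.Automorphic.Liu2021.AppendixC.RestOne
open Literature.NumberTheory.Automorphic.Liu2021.Def411WeilCarriers (lineOf locF Rep)
open Summit.HodgeConjecture.CorCM.Transposition.OmegaTransport (realUnit)
open HodgeCM.Model.ArchSideTerm (e₁)
open Literature.NumberTheory.GelbartRogawski1991 Literature.NumberTheory.GelbartRogawski1991.UnitaryDualPair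
open Literature.NumberTheory.GelbartRogawski1991.UnitaryDualPair.LocalSplitting (localMu norm_localMu continuous_localMu localMu_toLocalRing_eq_one_iff
  eq_of_forall_localMu_toHeckeCharacter_eq)
open Literature.RepresentationTheory Literature.RepresentationTheory.Liu2021
open Summit.HodgeConjecture.CorCM.Transposition
open Summit.HodgeConjecture.CorCM.D2Bridge.AdapterMuConj (muConj prop413AsPrinted_muConj def411_muConj nontrivial_omegaAt_muConj_rest)
open Summit.HodgeConjecture.CorCM.D2Bridge.MuKeyIdentEnd (hc_cm_of_printed_citations_muKey_ident)
open Summit.HodgeConjecture.CorCM.D2Bridge.MuKeyIdentLemD3End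
open Summit.HodgeConjecture.CorCM.D2Bridge.MuKeyIdentLemD3DelRecConjOmegaEnd (diagonal_frameD_map_complexConj)

open Summit.HodgeConjecture.CorCM.D2Bridge.MuKeyIdentLemD3DelRecConjOmegaEndT (hc_cm_of_printed_citations_muKey_ident_lemD3_delRecConjOmegaT)
open scoped DirectSum
open Summit.HodgeConjecture.CorCM.D2Bridge.MuKeyIdentLemD3DelRecConjOmegaEndT.PrintedCitationHypotheses (Hyp413 HypD3 HypD1pp)   -- v4: the decls OF RECORD by name (local copies deleted)
open Literature.NumberTheory.GelbartRogawski1991.OscillatorTripleDictionary (OccursInH1 IsIsoToOmega)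

/-! ## The two halves of [Liu21, Prop 4.13] as predicates on a `Prop413Data` (interface; generic) -/

section Items

variable {F₀ E₀ : Type} [Field F₀] [NumberField F₀] [IsTotallyReal F₀] [Field E₀] [NumberField E₀] [Algebra F₀ E₀]
  [IsTotallyComplex E₀] [Algebra.IsQuadraticExtension F₀ E₀]

/-- ANALYTIC HALF (Matsushima shape): `H¹_{B,τ'}(A_∞, ℂ)` is, `𝔾(𝔸_F^∞)`-equivariantly, a direct sum of IRREDUCIBLE representations
(«an admissible representation» l. 2081, semisimple: uniformisation (4.1)/(C.2), Lemma 2.4 (1), Matsushima–Murakami ∕ [BW00 VII.3.2, XIV], unitarity).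
[cite: Liu2021, Prop 4.13 proof l. 2121–2131; Lemma 2.4; (C.2)] [cite: BorelWallach2000, VII.3.2] -/
def HasIrredDecomposition (P : Prop413Data F₀ E₀) (τ' : E₀ →+* ℂ) : Prop :=
  ∃ (ι : Type) (W : ι → Type) (_ : ∀ i, AddCommGroup (W i)) (_ : ∀ i, Module ℂ (W i)) (ρ : ∀ i, Representation ℂ P.G (W i)),
    (∀ i, (ρ i).IsIrreducible) ∧
      ∃ Ψ : P.HB τ' ≃ₗ[ℂ] (⨁ i, W i), ∀ (g : P.G) (x : P.HB τ') (i : ι), Ψ (P.rhoB τ' g x) i = ρ i g (Ψ x i)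

/-- ARITHMETIC HALF (classification with multiplicity): in ANY equivariant decomposition of `H¹_{B,τ'}(A_∞, ℂ)` into irreducibles, the constituents are —
counted with multiplicity, i.e. through a bijection of index sets — exactly the adèlic oscillator representations `ω(μ,ε,χ)` over the triples with `μ` of weight
one and `ε` `μ`-admissible (`n = 3` route ONLY: [GR91 §3] + [Rog90 §13.3, Thm 13.3.1 (multiplicity one)] + [Rog92], Liu Rem 4.14; `π^∞ ≅ ω(μ,ε,χ)` by Howe
duality [GT16] and the Rallis inner product formula [Li92]; matching an arbitrary decomposition: Azumaya–Krull–Schmidt).  Does NOT assert that distinct triples give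
non-isomorphic modules. [cite: Liu2021, Prop 4.13 proof l. 2131–2146, Rem 4.14] [cite: GelbartRogawski1991, §3] [cite: Rogawski1990, Thm 13.3.1]
[cite: GanTakeda2016] [cite: Li1992] -/
def ConstituentsAreTheta (P : Prop413Data F₀ E₀) (τ' : E₀ →+* ℂ) : Prop :=
  ∀ (ι : Type) (W : ι → Type) [∀ i, AddCommGroup (W i)] [∀ i, Module ℂ (W i)] (ρ : ∀ i, Representation ℂ P.G (W i)),
    (∀ i, (ρ i).IsIrreducible) →
    ∀ Ψ : P.HB τ' ≃ₗ[ℂ] (⨁ i, W i), (∀ (g : P.G) (x : P.HB τ') (i : ι), Ψ (P.rhoB τ' g x) i = ρ i g (Ψ x i)) →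
      ∃ e : P.AdmTriple ≃ ι, ∀ t : P.AdmTriple, ∃ f : W (e t) ≃ₗ[ℂ] P.omegaAt t,
        ∀ (g : P.G) (w : W (e t)), f (ρ (e t) g w) = P.rhoAt t g (f w)

/-- Re-assembly of [Liu21, Prop 4.13] AS PRINTED from the two halves: take an irreducible decomposition `Ψ : H ≃ ⨁_i W_i`, the bijection `e : AdmTriple ≃ ι` and
the componentwise isomorphisms `f_t : W_{e t} ≃ ω_t`; the printed isomorphism is `Φ := Ψ ≫ (reindex along e) ≫ ⨁_t f_t`, and it is `𝔾(𝔸_F^∞)`-equivariant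
because `Ψ` and every `f_t` are.  Kernel-checked; no citation is discharged here. [cite: Liu2021, Prop 4.13] -/
theorem prop413AsPrinted_of_parts (P : Prop413Data F₀ E₀) (h1 : 3 ≤ P.n → ∀ τ' : E₀ →+* ℂ, HasIrredDecomposition P τ')
    (h2 : 3 ≤ P.n → ∀ τ' : E₀ →+* ℂ, ConstituentsAreTheta P τ') : Prop413AsPrinted P := by
  intro hn τ'
  classical
  obtain ⟨ι, W, instA, instM, ρ, hirr, Ψ, hΨ⟩ := h1 hn τ'
  obtain ⟨e, hef⟩ := h2 hn τ' ι W ρ hirr Ψ hΨ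
  choose f hf using hef
  -- reindex along `e` : `⨁_i W_i ≃ ⨁_t W_(e t)`
  let R : (⨁ i : ι, W i) ≃ₗ[ℂ] ⨁ t : P.AdmTriple, W (e t) := DirectSum.lequivCongrLeft ℂ e.symm
  -- componentwise `f_t`
  let C : (⨁ t : P.AdmTriple, W (e t)) ≃ₗ[ℂ] ⨁ t : P.AdmTriple, P.omegaAt t :=
    LinearEquiv.ofLinear (DirectSum.lmap fun t => (f t).toLinearMap) (DirectSum.lmap fun t => (f t).symm.toLinearMap)
      (by
        apply LinearMap.ext
        intro x
        apply DFinsupp.ext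
        intro t
        simp only [LinearMap.comp_apply, DirectSum.lmap_apply, LinearEquiv.coe_coe, LinearEquiv.apply_symm_apply,
          LinearMap.id_apply])
      (by
        apply LinearMap.ext
        intro x
        apply DFinsupp.ext
        intro t
        simp only [LinearMap.comp_apply, DirectSum.lmap_apply, LinearEquiv.coe_coe, LinearEquiv.symm_apply_apply,
          LinearMap.id_apply])
  let Φ : P.HB τ' ≃ₗ[ℂ] ⨁ t : P.AdmTriple, P.omegaAt t := Ψ.trans (R.trans C)
  have hΦ : ∀ (x : P.HB τ') (t : P.AdmTriple), Φ x t = f t (Ψ x (e t)) := by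
    intro x t
    show C (R (Ψ x)) t = _
    simp only [C, R, LinearEquiv.ofLinear_apply, DirectSum.lmap_apply, LinearEquiv.coe_coe]
    rfl
  refine ⟨Φ, fun g x t => ?_⟩
  rw [hΦ, hΦ, hΨ, hf]

/-- Converse bookkeeping: the printed proposition gives BOTH halves (so the cut loses nothing) — the decomposition `ι := AdmTriple`, `W_t := ω_t` is irreducible
termwise only if the `ω_t` are; we record the easy direction that needs no irreducibility: [Prop 4.13] ⇒ an equivariant decomposition indexed by the admissible
triples exists. [cite: Liu2021, Prop 4.13] -/
theorem decomposition_of_prop413AsPrinted (P : Prop413Data F₀ E₀) (h : Prop413AsPrinted P) (hn : 3 ≤ P.n) (τ' : E₀ →+* ℂ) :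
    ∃ Ψ : P.HB τ' ≃ₗ[ℂ] (⨁ t : P.AdmTriple, P.omegaAt t), ∀ (g : P.G) (x : P.HB τ') (t : P.AdmTriple), Ψ (P.rhoB τ' g x) t = P.rhoAt t g (Ψ x t) :=
  h hn τ'

end Items

/-! ## The binder, verbatim -/

set_option synthInstance.maxHeartbeats 400000 in
set_option maxHeartbeats 8000000 in
/-- The headline's fifth displayed binder `h413` — [Liu 2021, Prop 4.13] AS PRINTED at the tree's uniform [Def 4.11] family of `V` (scalar-keyed section `r_{a₀,i}`)
and the PIN's `H¹_{B}(A_∞, ℂ)` — copied BYTE-FOR-BYTE from `ClosedPrintedMuKeyIdentLemD3DelRecConjOmegaT.lean` :133–:135 (conformance: the `example` right below).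
[cite: Liu2021, Prop 4.13] -/
def H413 (hDel : Literature.AlgebraicGeometry.ShimuraVarieties.UnitaryCanonicalModel.canonicalModel_exists_printed) : Prop :=
  ∀ (F : HodgeCM.CMField) [IsGalois ℚ F] (h6 : 6 ≤ Module.finrank ℚ F) {ι₁ : F →+* ℂ} (V : HodgeCM.HermSpace3 F ι₁) (a₀ : RealScalar F)
      (Φ : CMType F) (hΦ : ι₁ ∈ Φ.1) (i : (I V (repAt a₀) (muLiu ι₁ GramClass.rep))), Prop413AsPrinted (((uniformOmegaRep (Summit.HodgeConjecture.CorCM.DelRec.exists_recordSystem_of_printed hDel) ⟨HodgeCM.CMField.K F⟩ ι₁ ⟨HodgeCM.HermSpace3.Hm V, HodgeCM.HermSpace3.isHermitian V, HodgeCM.HermSpace3.signature_ι₁ V, HodgeCM.HermSpace3.posDef_of_ne V⟩ Φ e₁ (frameD V) (frameD_real V) (frameD_ne V) (ιVE V) (2 * imagUnit (HodgeCM.CMField.K F))⁻¹ (fun _ _ => (Rep.update ↥(maximalRealSubfield (HodgeCM.CMField.K F)) (imagUnitSq (HodgeCM.CMField.K F)) (Rep.ofLineOf ↥(maximalRealSubfield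 (HodgeCM.CMField.K F)) (imagUnitSq (HodgeCM.CMField.K F))) (locF ↥(maximalRealSubfield (HodgeCM.CMField.K F)) (imagUnitSq (HodgeCM.CMField.K F)) (realUnit ⟨HodgeCM.CMField.K F⟩ (repAt a₀ (Sigma.fst i)).1 (repAt a₀ (Sigma.fst i)).2.1 (repAt a₀ (Sigma.fst i)).2.2)) (realUnit ⟨HodgeCM.CMField.K F⟩ (repAt a₀ (Sigma.fst i)).1 (repAt a₀ (Sigma.fst i)).2.1 (repAt a₀ (Sigma.fst i)).2.2) rfl)))).prop413Data ((liuDictionaryPin exists_isReal_hodgeModel_holds hodgePQ_independent_of_hodgeModel_holds BallQuotient.ballQuotientUniformised_holds (cmAbelianVarietyRealised_of_eigenbasis exists_isReal_hodgeModel_holds hodgePQ_independent_of_hodgeModel_holds cmAbelianVarietyEigenbasisRealised_holds) Literature.NumberTheory.Transcendental.arapura2012_cor_15_4_6_holds V (I V (repAt a₀) (muLiu ι₁ GramClass.rep)) (line V (repAt a₀) (muLiu ι₁ GramClass.rep)))).H)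

set_option synthInstance.maxHeartbeats 400000 in
set_option maxHeartbeats 8000000 in
/-- CONFORMANCE (kernel): `H413 hDel` IS the type of the headline's `h413` slot (rows 3 and 4 are λ-bound with their types inferred from the headline).
HC_CM is proved only modulo the 7 printed citations. [cite: Liu2021, Prop 4.13] -/
example (hDel : Literature.AlgebraicGeometry.ShimuraVarieties.UnitaryCanonicalModel.canonicalModel_exists_printed)
    (h21 : shimura1998_thm21_4_casselman) (h : H413 hDel) :=
  fun hLiu418 h411 => hc_cm_of_printed_citations_muKey_ident_lemD3_delRecConjOmegaT hDel h21 hLiu418 h411 h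

set_option synthInstance.maxHeartbeats 400000 in
set_option maxHeartbeats 8000000 in
/-- CONFORMANCE WITH THE DECL OF RECORD (kernel, `Iff.rfl`): `Hyp413` (= the landed `PrintedCitationHypotheses.Hyp413`, character-identical) IS `∀ hDel, H413 hDel`.
HC_CM is proved only modulo the 7 printed citations. [cite: Liu2021, Prop 4.13] -/
theorem hyp413_iff : Hyp413 ↔ ∀ hDel, H413 hDel :=
  Iff.rfl

/-! ## The printed datum `P(F, V, a₀, Φ, i)` -/

set_option synthInstance.maxHeartbeats 400000 in
set_option maxHeartbeats 8000000 in
/-- `P(F, V, a₀, Φ, i) = 𝕌_V.prop413Data H` — the argument of `Prop413AsPrinted` in the `h413` row, byte-for-byte: the tree's uniform [Def 4.11 ∕ 4.12] family of `V`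
at the scalar-keyed section `r_{a₀,i}`, over the PIN's `H¹_B(A_∞, ℂ)` with its Hecke action.  Fields: see the module docstring. [cite: Liu2021, Def 4.11, Prop 4.13] -/
def datum413 (hDel : Literature.AlgebraicGeometry.ShimuraVarieties.UnitaryCanonicalModel.canonicalModel_exists_printed)
    (F : HodgeCM.CMField) [IsGalois ℚ F] {ι₁ : F →+* ℂ} (V : HodgeCM.HermSpace3 F ι₁) (a₀ : RealScalar F)
      (Φ : CMType F) (i : (I V (repAt a₀) (muLiu ι₁ GramClass.rep))) :
    Prop413Data ↥(maximalRealSubfield (HodgeCM.CMField.K F)) (HodgeCM.CMField.K F) :=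
  ((uniformOmegaRep (Summit.HodgeConjecture.CorCM.DelRec.exists_recordSystem_of_printed hDel) ⟨HodgeCM.CMField.K F⟩ ι₁ ⟨HodgeCM.HermSpace3.Hm V, HodgeCM.HermSpace3.isHermitian V, HodgeCM.HermSpace3.signature_ι₁ V, HodgeCM.HermSpace3.posDef_of_ne V⟩ Φ e₁ (frameD V) (frameD_real V) (frameD_ne V) (ιVE V) (2 * imagUnit (HodgeCM.CMField.K F))⁻¹ (fun _ _ => (Rep.update ↥(maximalRealSubfield (HodgeCM.CMField.K F)) (imagUnitSq (HodgeCM.CMField.K F)) (Rep.ofLineOf ↥(maximalRealSubfield (HodgeCM.CMField.K F)) (imagUnitSq (HodgeCM.CMField.K F))) (locF ↥(maximalRealSubfield (HodgeCM.CMField.K F)) (imagUnitSq (HodgeCM.CMField.K F)) (realUnit ⟨HodgeCM.CMField.K F⟩ (repAt a₀ (Sigma.fst i)).1 (repAt a₀ (Sigma.fst i)).2.1 (repAt a₀ (Sigma.fst i)).2.2)) (realUnit ⟨HodgeCM.CMField.K F⟩ (repAt a₀ (Sigma.fst i)).1 (repAt a₀ (Sigma.fst i)).2.1 (repAt a₀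 (Sigma.fst i)).2.2) rfl)))).prop413Data ((liuDictionaryPin exists_isReal_hodgeModel_holds hodgePQ_independent_of_hodgeModel_holds BallQuotient.ballQuotientUniformised_holds (cmAbelianVarietyRealised_of_eigenbasis exists_isReal_hodgeModel_holds hodgePQ_independent_of_hodgeModel_holds cmAbelianVarietyEigenbasisRealised_holds) Literature.NumberTheory.Transcendental.arapura2012_cor_15_4_6_holds V (I V (repAt a₀) (muLiu ι₁ GramClass.rep)) (line V (repAt a₀) (muLiu ι₁ GramClass.rep)))).H

/-! ## Registered stubs (Liu's printed proof of Prop 4.13) -/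

set_option synthInstance.maxHeartbeats 400000 in
set_option maxHeartbeats 8000000 in
/-- STUB TYPE (analytic half), closed over `hDel` like the decl of record, at the printed datum under the face prefix. -/
def StubIrredDecomposition : Prop :=
  ∀ (hDel : Literature.AlgebraicGeometry.ShimuraVarieties.UnitaryCanonicalModel.canonicalModel_exists_printed)
      (F : HodgeCM.CMField) [IsGalois ℚ F] (h6 : 6 ≤ Module.finrank ℚ F) {ι₁ : F →+* ℂ} (V : HodgeCM.HermSpace3 F ι₁) (a₀ : RealScalar F)
      (Φ : CMType F) (hΦ : ι₁ ∈ Φ.1) (i : (I V (repAt a₀) (muLiu ι₁ GramClass.rep))),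
      3 ≤ (datum413 hDel F V a₀ Φ i).n → ∀ τ' : HodgeCM.CMField.K F →+* ℂ, HasIrredDecomposition (datum413 hDel F V a₀ Φ i) τ'

set_option synthInstance.maxHeartbeats 400000 in
set_option maxHeartbeats 8000000 in
/-- STUB TYPE (v2, junction J1 «Matsushima at the PIN», row III-4 AT THE PIN; text = A-p09's IFACE-ROW 01:21:45Z verbatim): for every face prefix and every
admissible triple index `i`, if `3 ≤ n` then for every `τ'` the PIN's `H¹_{B,τ'}(A_∞, ℂ)` with its Hecke action `rhoB τ'` is a SEMISIMPLE representation of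
`U(V)(𝔸_{F⁺,f})` (every subrepresentation has a complement; Mathlib `Representation.IsSemisimpleRepresentation`).
[cite: Liu2021, Prop. 4.13 proof l. 2121–2131, App. D (D.1)] [cite: BorelWallach2000, VII 3.2] -/
def StubMatsushimaAtPin : Prop :=
  ∀ (hDel : Literature.AlgebraicGeometry.ShimuraVarieties.UnitaryCanonicalModel.canonicalModel_exists_printed)
      (F : HodgeCM.CMField) [IsGalois ℚ F] (h6 : 6 ≤ Module.finrank ℚ F) {ι₁ : F →+* ℂ} (V : HodgeCM.HermSpace3 F ι₁) (a₀ : RealScalar F)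
      (Φ : CMType F) (hΦ : ι₁ ∈ Φ.1) (i : (I V (repAt a₀) (muLiu ι₁ GramClass.rep))),
      3 ≤ (datum413 hDel F V a₀ Φ i).n → ∀ τ' : HodgeCM.CMField.K F →+* ℂ,
        ((datum413 hDel F V a₀ Φ i).rhoB τ').IsSemisimpleRepresentation

set_option synthInstance.maxHeartbeats 400000 in
set_option maxHeartbeats 8000000 in
/-- STUB TYPE (arithmetic half), closed over `hDel`, at the printed datum under the face prefix. -/
def StubConstituentsTheta : Prop :=
  ∀ (hDel : Literature.AlgebraicGeometry.ShimuraVarieties.UnitaryCanonicalModel.canonicalModel_exists_printed)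
      (F : HodgeCM.CMField) [IsGalois ℚ F] (h6 : 6 ≤ Module.finrank ℚ F) {ι₁ : F →+* ℂ} (V : HodgeCM.HermSpace3 F ι₁) (a₀ : RealScalar F)
      (Φ : CMType F) (hΦ : ι₁ ∈ Φ.1) (i : (I V (repAt a₀) (muLiu ι₁ GramClass.rep))),
      3 ≤ (datum413 hDel F V a₀ Φ i).n → ∀ τ' : HodgeCM.CMField.K F →+* ℂ, ConstituentsAreTheta (datum413 hDel F V a₀ Φ i) τ'

set_option synthInstance.maxHeartbeats 400000 in
set_option maxHeartbeats 8000000 in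
/-- STUB TYPE (v4, junction J2a «oscillator-triple dictionary AT THE PIN — EXISTENCE half», the first clause of row B3-12 (a) read at the printed
datum; A-p10): for every face prefix and every admissible index `i`, at `n = 3`, every IRREDUCIBLE `U(V)(𝔸_{F⁺,f})`-representation `σ` occurring in
the PIN's `H¹_{B,τ'}(A_∞, ℂ)` (`OccursInH1`) is `≅ ω_V(μ, ε, χ)` (`IsIsoToOmega`) for SOME admissible weight-one triple.  The UNIQUENESS of the label
(second clause of `oscillatorTriple_dictionary`, [GR91, p. 447 L6–8]) is NOT registered: among admissible weight-one labels it follows from the rows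
`hD3`, `hD1''` (`sep_admTriple_datum413_of_hypD3_hypD1pp` below, A-p10 p597994).  FAN B ∕ B-III: Rogawski's classification + [GR91] Thm 5.1.1.
[cite: GelbartRogawski1991, Introduction p. 448 L30–33; Thm 5.1.1 p. 465] [cite: Liu2021, Rem. 4.14; proof of Prop. 4.13 l. 2145] -/
def StubDictionaryExistenceAtPin : Prop :=
  ∀ (hDel : Literature.AlgebraicGeometry.ShimuraVarieties.UnitaryCanonicalModel.canonicalModel_exists_printed)
      (F : HodgeCM.CMField) [IsGalois ℚ F] (h6 : 6 ≤ Module.finrank ℚ F) {ι₁ : F →+* ℂ} (V : HodgeCM.HermSpace3 F ι₁) (a₀ : RealScalar F)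
      (Φ : CMType F) (hΦ : ι₁ ∈ Φ.1) (i : (I V (repAt a₀) (muLiu ι₁ GramClass.rep))),
      (datum413 hDel F V a₀ Φ i).n = 3 → ∀ (τ' : HodgeCM.CMField.K F →+* ℂ) (W₀ : Type) [AddCommGroup W₀] [Module ℂ W₀]
        (σ : Representation ℂ (datum413 hDel F V a₀ Φ i).G W₀),
        σ.IsIrreducible → OccursInH1 (datum413 hDel F V a₀ Φ i) τ' σ → ∃ t : (datum413 hDel F V a₀ Φ i).AdmTriple, IsIsoToOmega (datum413 hDel F V a₀ Φ i) σ t.1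

set_option synthInstance.maxHeartbeats 400000 in
set_option maxHeartbeats 8000000 in
/-- STUB TYPE (v3, junction J3 «multiplicity one AT THE PIN», [Liu2021, proof of Prop. 4.13, l. 2145] read at the printed datum; A-p10's IFACE-ROW): for
every face prefix and every admissible index `i`, `(datum413 …).MultOneAsPrinted` — if `3 ≤ n` then for every `τ'` and every admissible weight-one
triple `t`, `dim_ℂ Hom_{ℂ[U(V)(𝔸_{F⁺,f})]}(ω_V(t), H¹_{B,τ'}(A_∞, ℂ)) = 1` (✔ `Liu2021/Prop413MultOneAsPrinted.lean`; FAN B ∕ B-III: [Rog90, Thm 13.3.1] multiplicity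
one for `U(3)` + uniqueness of the triple + `dim H¹(𝔤,K;π_∞)_{τ'} = 1` + occurrence by [Li92] ∕ Rallis).
[cite: Liu2021, proof of Prop. 4.13, l. 2145] [cite: Rogawski1990, Thm. 13.3.1] -/
def StubMultOneAtPin : Prop :=
  ∀ (hDel : Literature.AlgebraicGeometry.ShimuraVarieties.UnitaryCanonicalModel.canonicalModel_exists_printed)
      (F : HodgeCM.CMField) [IsGalois ℚ F] (h6 : 6 ≤ Module.finrank ℚ F) {ι₁ : F →+* ℂ} (V : HodgeCM.HermSpace3 F ι₁) (a₀ : RealScalar F)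
      (Φ : CMType F) (hΦ : ι₁ ∈ Φ.1) (i : (I V (repAt a₀) (muLiu ι₁ GramClass.rep))),
      (datum413 hDel F V a₀ Φ i).MultOneAsPrinted

/-! ### v3 — J1 SPLIT (A-p09 IFACE-ROW 01:41:03Z + MILESTONE 01:50:47Z; B-plan2 CUT ENDORSED 02:12:35Z; director 02:08:08Z «v3 = J1(b) + J2 + J3 + (irr)»):
the junction «Matsushima at the pin» is GLUED from (a) admissibility, (d) smoothness, (b) unitarizability at the pin by (c) Getz–Hahn Ex. 5.4 (p593622, kernel). -/

/-- STUB TYPE (v3, J1 (a); A-p09's text verbatim) — ADMISSIBILITY AT THE PIN ([Liu2021] §4.2 l. 2081 «which is an admissible representation of `𝔾(𝔸_F^∞)`»,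
READING I2 second half): for every open compact `K ≤ U(V)(𝔸_{F⁺,f})` the `K`-fixed vectors of the PIN's `H¹_{B,τ'}(A_∞, ℂ)` are finite-dimensional
(`dim_ℂ H_K < ∞`: finiteness of `U(V)(L₀)\U(V)(𝔸_f)/K` via Godement compactness × `dim H¹(P_Γ(ℂ);ℚ) < ∞`).  Row «III-4a at the PIN».
[cite: Liu2021, §4.2 l. 2081] -/
def StubAdmissibleAtPin : Prop :=
  ∀ (hDel : Literature.AlgebraicGeometry.ShimuraVarieties.UnitaryCanonicalModel.canonicalModel_exists_printed)
      (F : HodgeCM.CMField) [IsGalois ℚ F] (h6 : 6 ≤ Module.finrank ℚ F) {ι₁ : F →+* ℂ} (V : HodgeCM.HermSpace3 F ι₁) (a₀ : RealScalar F)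
      (Φ : CMType F) (hΦ : ι₁ ∈ Φ.1) (i : (I V (repAt a₀) (muLiu ι₁ GramClass.rep))),
      3 ≤ (datum413 hDel F V a₀ Φ i).n → ∀ τ' : HodgeCM.CMField.K F →+* ℂ,
        Literature.NumberTheory.Automorphic.Liu2021.IsAdmissibleRep ((datum413 hDel F V a₀ Φ i).rhoB τ')

/-- STUB TYPE (v3, J1 (d)) — SMOOTHNESS AT THE PIN ([Liu2021] §4.2 l. 2081, READING I2 first half): every vector of the PIN's `H¹_{B,τ'}(A_∞, ℂ)` is
fixed by an open subgroup of `U(V)(𝔸_{F⁺,f})` (it comes from a finite level `K` and is `K`-fixed — `TowerCarrier`/`TowerFixed`).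
[cite: Liu2021, §4.2 l. 2081] -/
def StubSmoothAtPin : Prop :=
  ∀ (hDel : Literature.AlgebraicGeometry.ShimuraVarieties.UnitaryCanonicalModel.canonicalModel_exists_printed)
      (F : HodgeCM.CMField) [IsGalois ℚ F] {ι₁ : F →+* ℂ} (V : HodgeCM.HermSpace3 F ι₁) (a₀ : RealScalar F)
      (Φ : CMType F) (i : (I V (repAt a₀) (muLiu ι₁ GramClass.rep))) (τ' : HodgeCM.CMField.K F →+* ℂ),
      Literature.NumberTheory.Automorphic.Liu2021.IsSmoothRep ((datum413 hDel F V a₀ Φ i).rhoB τ')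

/-- STUB TYPE (v3, J1 (b); A-p09's text verbatim) — UNITARIZABILITY AT THE PIN (the Hecke-invariant polarisation): the PIN's `H¹_{B,τ'}(A_∞, ℂ)` carries a
`U(V)(𝔸_{F⁺,f})`-invariant positive-definite Hermitian form (tree predicate `Representation.IsUnitarizable`, `MatrixCoefficients.lean` :311) — in nature the
Hodge–Riemann form `(α,β) ↦ i∫ α₁₀∧β̄₁₀∧ω − i∫ α₀₁∧β̄₀₁∧ω` on `H¹(X_K(ℂ);ℂ)`, normalised by `[K₀:K]`, `ω = c₁(K_X)` pulled back along the Hecke translates;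
absent from `HodgeCM.Universe` (inputs (b1) Hodge–Riemann in degree 1 WITH SIGN, (b2) the class `c₁(K_X)` with ampleness + finite-étale functoriality, (b3) the
degree formula — B-typ03 B3-24/25/26 —, (b4) colimit glue; SPEC `A-provers/A-p09/SPEC-III4b-UnitarizableAtPin.md`; by p595456 a SIMILITUDE-invariant form with
`χ = 1` on `K_f(3)` suffices — re-glue in one line).  Row «III-4b at the PIN».
[cite: Liu2021, Prop. 4.13 proof l. 2121–2131] [cite: BorelWallach2000, VII 3.1–3.2] [cite: Voisin2002, Thm. 6.32] -/
def StubUnitarizableAtPin : Prop :=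
  ∀ (hDel : Literature.AlgebraicGeometry.ShimuraVarieties.UnitaryCanonicalModel.canonicalModel_exists_printed)
      (F : HodgeCM.CMField) [IsGalois ℚ F] (h6 : 6 ≤ Module.finrank ℚ F) {ι₁ : F →+* ℂ} (V : HodgeCM.HermSpace3 F ι₁) (a₀ : RealScalar F)
      (Φ : CMType F) (hΦ : ι₁ ∈ Φ.1) (i : (I V (repAt a₀) (muLiu ι₁ GramClass.rep))),
      3 ≤ (datum413 hDel F V a₀ Φ i).n → ∀ τ' : HodgeCM.CMField.K F →+* ℂ,
        ((datum413 hDel F V a₀ Φ i).rhoB τ').IsUnitarizable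

end Summit.HodgeConjecture.CorCM.Lines.A3Liu413

end
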